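import Mathlib
import Literature.Computability.Complexity.IntegerProgrammingFixedDimension
import HarnessLib

/-!
# Lenstra's algorithm in fixed dimension, IV: hyperplane sections as lower-dimensional instances

Topic `Computability/Complexity`, grouping namespace `FixedDimILP`. The recursion of Lenstra's
algorithm (Lenstra 1983, §1, "the problem is reduced to a bounded number of lower dimensional
problems"; Schrijver 1986, Cor. 18.7a, (64)–(65)): the integer points of `{x | Ax ≤ b}` on the hyperplane
`c · x = κ` are parametrised by `ℤ^{N-1}` through a unimodular matrix `U` whose inverse `U'` has `c` as
its last column — `x = (z, κ) U` (row vector times `U`), `z ∈ ℤ^{N-1}` — and in the parameter `z` the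
system reads `(a Uⱼᵀ)_{j<N-1} · z ≤ β - κ (a · U_{N-1})`, an INTEGER system in `N - 1` variables. On the
tree's vocabulary `ILPInstance` (`IntegerProgrammingFixedDimension.lean`):

* `paramPoint U κ z = (Fin.snoc z κ) ᵥ* U`, `sectionRow U κ (a, β)`, `sectionRows`, `sectionInstance rows U κ`;
* `dotProduct_paramPoint`, `rowHolds_sectionRow_iff` — a row holds at `paramPoint U κ z` iff its section
  holds at `z`; hence `feasible_of_feasible_sectionInstance` (SOUNDNESS of the recursion, no hypothesis
  on `U`) and, for `U' U = 1`, `paramPoint_of_vecMul_last` (every integer `x` with `(x U')_{last} = κ` is a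
  `paramPoint`) and `feasible_sectionInstance_of` (COMPLETENESS of the recursion);
* `isBounded_sectionInstance` — for `U U' = 1` the section of a bounded instance is bounded (its real
  polyhedron is an affine preimage, and `z = ((z, κ) U) U'` recovers `z` linearly).

## References

* H. W. Lenstra, Jr., *Integer programming with a fixed number of variables*, Math. Oper. Res. 8 (1983)
  538–548, §1, p. 541 ("If we fix the value of `k` then we restrict attention to those `x = Σ yᵢbᵢ` for
  which `yₙ = k`; this leads to an integer programming problem with `n - 1` variables … Each of the lower
  dimensional problems is treated recursively. The case of dimension `n = 1` (or even `n = 0`) may serve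
  as a basis for the recursion"). [LenstraHW1983]
* A. Schrijver, *Theory of Linear and Integer Programming*, Wiley 1986, Cor. 18.7a ((64)–(65): the
  polyhedra `P_t`, `Q_t`). [Schrijver1986]
-/

namespace Literature.Computability.Complexity

namespace FixedDimILP

open Matrix Finset ILPInstance

variable {k : ℕ}

/-! ### The parametrisation and the section of a row -/

/-- `a · ((z, κ) M) = Σⱼ zⱼ (a · Mⱼ) + κ (a · M_last)` over any commutative ring. [folklore] -/
theorem dotProduct_snoc_vecMul {R : Type} [CommRing R] (a : Fin (k + 1) → R) (z : Fin k → R) (κ : R)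
    (M : Matrix (Fin (k + 1)) (Fin (k + 1)) R) :
    a ⬝ᵥ ((Fin.snoc z κ : Fin (k + 1) → R) ᵥ* M) =
      ∑ j, z j * (a ⬝ᵥ M (Fin.castSucc j)) + κ * (a ⬝ᵥ M (Fin.last k)) := by
  rw [dotProduct_comm, ← dotProduct_mulVec, dotProduct, Fin.sum_univ_castSucc]
  simp only [Fin.snoc_castSucc, Fin.snoc_last, mulVec]
  simp only [dotProduct_comm]

/-- The integer point with section coordinates `z ∈ ℤ^k` on the level `κ`: `(z, κ) ᵥ* U`, i.e.
`κ U_last + Σⱼ zⱼ Uⱼ` (rows of `U`). [cite: Schrijver1986, Cor. 18.7a (65)] -/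
def paramPoint (U : Matrix (Fin (k + 1)) (Fin (k + 1)) ℤ) (κ : ℤ) (z : Fin k → ℤ) : Fin (k + 1) → ℤ :=
  (Fin.snoc z κ : Fin (k + 1) → ℤ) ᵥ* U

/-- The SECTION of a row `(a, β)`: coefficients `a · Uⱼ` (`j < k`), right-hand side `β - κ (a · U_last)`.
[cite: Schrijver1986, Cor. 18.7a (65)] -/
def sectionRow (U : Matrix (Fin (k + 1)) (Fin (k + 1)) ℤ) (κ : ℤ) (r : (Fin (k + 1) → ℤ) × ℤ) :
    (Fin k → ℤ) × ℤ :=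
  (fun j => r.1 ⬝ᵥ U (Fin.castSucc j), r.2 - κ * (r.1 ⬝ᵥ U (Fin.last k)))

/-- The sectioned rows. [cite: Schrijver1986, Cor. 18.7a (65)] -/
def sectionRows (rows : List ((Fin (k + 1) → ℤ) × ℤ)) (U : Matrix (Fin (k + 1)) (Fin (k + 1)) ℤ) (κ : ℤ) :
    List ((Fin k → ℤ) × ℤ) :=
  rows.map (sectionRow U κ)

/-- The section instance: `k` variables, every row sectioned. [cite: Schrijver1986, Cor. 18.7a (65)] -/
def sectionInstance (rows : List ((Fin (k + 1) → ℤ) × ℤ)) (U : Matrix (Fin (k + 1)) (Fin (k + 1)) ℤ) (κ : ℤ) :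
    ILPInstance :=
  ⟨k, sectionRows rows U κ⟩

/-- The section instance has `k` variables. [folklore] -/
@[simp] theorem numVars_sectionInstance (rows : List ((Fin (k + 1) → ℤ) × ℤ))
    (U : Matrix (Fin (k + 1)) (Fin (k + 1)) ℤ) (κ : ℤ) : (sectionInstance rows U κ).numVars = k := rfl

/-- `a · ((z, κ) U) = (a · Uⱼ)ⱼ · z + κ (a · U_last)`. [folklore] -/
theorem dotProduct_paramPoint (U : Matrix (Fin (k + 1)) (Fin (k + 1)) ℤ) (κ : ℤ) (z : Fin k → ℤ)
    (a : Fin (k + 1) → ℤ) :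
    a ⬝ᵥ paramPoint U κ z = (fun j => a ⬝ᵥ U (Fin.castSucc j)) ⬝ᵥ z + κ * (a ⬝ᵥ U (Fin.last k)) := by
  rw [paramPoint, dotProduct_snoc_vecMul]
  simp only [dotProduct, mul_comm]

/-- **A row holds at the parametrised point iff its section holds at the parameter.**
[cite: Schrijver1986, Cor. 18.7a ((64)–(65))] -/
theorem rowHolds_sectionRow_iff (U : Matrix (Fin (k + 1)) (Fin (k + 1)) ℤ) (κ : ℤ) (r : (Fin (k + 1) → ℤ) × ℤ)
    (z : Fin k → ℤ) : RowHolds (sectionRow U κ r) z ↔ RowHolds r (paramPoint U κ z) := by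
  change (fun j => r.1 ⬝ᵥ U (Fin.castSucc j)) ⬝ᵥ z ≤ r.2 - κ * (r.1 ⬝ᵥ U (Fin.last k)) ↔
    r.1 ⬝ᵥ paramPoint U κ z ≤ r.2
  rw [dotProduct_paramPoint]
  constructor <;> intro h <;> linarith

/-- Feasibility of the section instance on the explicit rows. [folklore] -/
theorem feasible_sectionInstance_iff_rows (rows : List ((Fin (k + 1) → ℤ) × ℤ))
    (U : Matrix (Fin (k + 1)) (Fin (k + 1)) ℤ) (κ : ℤ) :
    (sectionInstance rows U κ).Feasible ↔ ∃ z : Fin k → ℤ, ∀ r ∈ sectionRows rows U κ, RowHolds r z :=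
  Iff.rfl

/-- Feasibility of the section instance, unfolded. [folklore] -/
theorem feasible_sectionInstance_iff (rows : List ((Fin (k + 1) → ℤ) × ℤ))
    (U : Matrix (Fin (k + 1)) (Fin (k + 1)) ℤ) (κ : ℤ) :
    (sectionInstance rows U κ).Feasible ↔ ∃ z : Fin k → ℤ, ∀ r ∈ rows, RowHolds r (paramPoint U κ z) := by
  rw [feasible_sectionInstance_iff_rows]
  simp only [sectionRows, List.forall_mem_map, rowHolds_sectionRow_iff]

/-- **Soundness of the recursion**: a feasible section makes the instance feasible (the parametrised
point is an integer solution) — for ANY integer matrix `U`. [cite: Schrijver1986, Cor. 18.7a] -/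
theorem feasible_of_feasible_sectionInstance {rows : List ((Fin (k + 1) → ℤ) × ℤ)}
    {U : Matrix (Fin (k + 1)) (Fin (k + 1)) ℤ} {κ : ℤ} (h : (sectionInstance rows U κ).Feasible) :
    Feasible ⟨k + 1, rows⟩ := by
  obtain ⟨z, hz⟩ := (feasible_sectionInstance_iff rows U κ).1 h
  exact ⟨paramPoint U κ z, hz⟩

/-! ### With a unimodular `U`: every point of the level set is parametrised -/

/-- If `U' U = 1` then `x = ((x U')_{<last}, (x U')_{last}) U`: every integer point whose last
`U'`-coordinate is `κ` is a parametrised point of the level `κ`. [cite: Schrijver1986, Cor. 18.7a (the bijection `Φ`)] -/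
theorem paramPoint_of_vecMul_last {U U' : Matrix (Fin (k + 1)) (Fin (k + 1)) ℤ} (hU : U' * U = 1)
    (x : Fin (k + 1) → ℤ) :
    paramPoint U ((x ᵥ* U') (Fin.last k)) (fun j => (x ᵥ* U') (Fin.castSucc j)) = x := by
  have hsnoc : (Fin.snoc (fun j => (x ᵥ* U') (Fin.castSucc j)) ((x ᵥ* U') (Fin.last k)) : Fin (k + 1) → ℤ) =
      x ᵥ* U' := by
    ext i
    refine Fin.lastCases ?_ (fun j => ?_) i
    · simp
    · simp
  rw [paramPoint, hsnoc, vecMul_vecMul, hU, vecMul_one]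

/-- The last `U'`-coordinate is the dot product with the last column `c` of `U'`. [folklore] -/
theorem vecMul_last_eq_dotProduct (U' : Matrix (Fin (k + 1)) (Fin (k + 1)) ℤ) (x : Fin (k + 1) → ℤ) :
    (x ᵥ* U') (Fin.last k) = (fun i => U' i (Fin.last k)) ⬝ᵥ x := by
  simp [vecMul, dotProduct, mul_comm]

/-- **Completeness of the recursion**: if `U' U = 1` and the instance has an integer solution `x` with
`c · x = κ` (`c` the last column of `U'`), then the section at level `κ` is feasible.
[cite: Schrijver1986, Cor. 18.7a] -/
theorem feasible_sectionInstance_of {rows : List ((Fin (k + 1) → ℤ) × ℤ)}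
    {U U' : Matrix (Fin (k + 1)) (Fin (k + 1)) ℤ} (hU : U' * U = 1) {κ : ℤ} {x : Fin (k + 1) → ℤ}
    (hx : ∀ r ∈ rows, RowHolds r x) (hκ : (fun i => U' i (Fin.last k)) ⬝ᵥ x = κ) :
    (sectionInstance rows U κ).Feasible := by
  rw [feasible_sectionInstance_iff]
  refine ⟨fun j => (x ᵥ* U') (Fin.castSucc j), fun r hr => ?_⟩
  rw [← hκ, ← vecMul_last_eq_dotProduct, paramPoint_of_vecMul_last hU]
  exact hx r hr

/-! ### Boundedness is inherited -/

/-- The real parametrised point `(z, κ) ᵥ* U` for real `z`. [folklore] -/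
def paramPointR (U : Matrix (Fin (k + 1)) (Fin (k + 1)) ℤ) (κ : ℤ) (z : Fin k → ℝ) : Fin (k + 1) → ℝ :=
  (Fin.snoc z (κ : ℝ) : Fin (k + 1) → ℝ) ᵥ* U.map (Int.cast : ℤ → ℝ)

/-- The real section identity: `Σⱼ (a · Uⱼ) zⱼ = a · ((z, κ) U) - κ (a · U_last)` (reals). [folklore] -/
theorem sum_sectionRow_mul (U : Matrix (Fin (k + 1)) (Fin (k + 1)) ℤ) (κ : ℤ) (r : (Fin (k + 1) → ℤ) × ℤ)
    (z : Fin k → ℝ) :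
    ∑ j, ((sectionRow U κ r).1 j : ℝ) * z j =
      ∑ i, (r.1 i : ℝ) * paramPointR U κ z i -
        (κ : ℝ) * ((fun i => (r.1 i : ℝ)) ⬝ᵥ (U.map (Int.cast : ℤ → ℝ)) (Fin.last k)) := by
  have hcoef : ∀ j : Fin k, ((sectionRow U κ r).1 j : ℝ) =
      (fun i => (r.1 i : ℝ)) ⬝ᵥ (U.map (Int.cast : ℤ → ℝ)) (Fin.castSucc j) := by
    intro j
    simp [sectionRow, dotProduct, Matrix.map_apply]
  have hmain : ∑ i, (r.1 i : ℝ) * paramPointR U κ z i =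
      (fun i => (r.1 i : ℝ)) ⬝ᵥ ((Fin.snoc z (κ : ℝ) : Fin (k + 1) → ℝ) ᵥ* U.map (Int.cast : ℤ → ℝ)) := rfl
  rw [hmain, dotProduct_snoc_vecMul]
  simp only [hcoef]
  ring_nf
  simp only [mul_comm]

/-- Membership in the polyhedron of the section instance, on the explicit rows. [folklore] -/
theorem mem_polyhedron_sectionInstance_iff_rows (rows : List ((Fin (k + 1) → ℤ) × ℤ))
    (U : Matrix (Fin (k + 1)) (Fin (k + 1)) ℤ) (κ : ℤ) (z : Fin k → ℝ) :
    z ∈ (sectionInstance rows U κ).polyhedron ↔ ∀ r ∈ sectionRows rows U κ, ∑ j, (r.1 j : ℝ) * z j ≤ r.2 :=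
  Iff.rfl

/-- The real polyhedron of the section is the preimage of the polyhedron under the parametrisation.
[cite: Schrijver1986, Cor. 18.7a (65)] -/
theorem mem_polyhedron_sectionInstance_iff (rows : List ((Fin (k + 1) → ℤ) × ℤ))
    (U : Matrix (Fin (k + 1)) (Fin (k + 1)) ℤ) (κ : ℤ) (z : Fin k → ℝ) :
    z ∈ (sectionInstance rows U κ).polyhedron ↔ paramPointR U κ z ∈ polyhedron ⟨k + 1, rows⟩ := by
  rw [mem_polyhedron_sectionInstance_iff_rows, mem_polyhedron_iff]
  simp only [sectionRows, List.forall_mem_map, sum_sectionRow_mul]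
  refine forall₂_congr fun r _ => ?_
  have h2 : ((sectionRow U κ r).2 : ℝ) =
      (r.2 : ℝ) - (κ : ℝ) * ((fun i => (r.1 i : ℝ)) ⬝ᵥ (U.map (Int.cast : ℤ → ℝ)) (Fin.last k)) := by
    simp [sectionRow, dotProduct, Matrix.map_apply]
  rw [h2]
  constructor <;> intro h <;> linarith

/-- Recovering the parameter: if `U U' = 1` then `zⱼ = Σᵢ ((z, κ) U)ᵢ U'ᵢⱼ`. [folklore] -/
theorem param_eq_sum_paramPointR {U U' : Matrix (Fin (k + 1)) (Fin (k + 1)) ℤ} (hU : U * U' = 1) (κ : ℤ)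
    (z : Fin k → ℝ) (j : Fin k) :
    z j = ∑ i, paramPointR U κ z i * (U' i (Fin.castSucc j) : ℝ) := by
  have hmap : (U.map (Int.cast : ℤ → ℝ)) * (U'.map (Int.cast : ℤ → ℝ)) = 1 := by
    change (Int.castRingHom ℝ).mapMatrix U * (Int.castRingHom ℝ).mapMatrix U' = 1
    rw [← map_mul, hU, map_one]
  have h : (Fin.snoc z (κ : ℝ) : Fin (k + 1) → ℝ) = paramPointR U κ z ᵥ* U'.map (Int.cast : ℤ → ℝ) := by
    rw [paramPointR, vecMul_vecMul, hmap, vecMul_one]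
  have := congrFun h (Fin.castSucc j)
  simp only [Fin.snoc_castSucc] at this
  rw [this]
  simp [vecMul, dotProduct, Matrix.map_apply]

/-- **The section of a bounded instance is bounded** (`U U' = 1`): its real polyhedron is the preimage
of the bounded polyhedron under `z ↦ (z, κ) U`, and `z` is recovered linearly from `(z, κ) U`.
[cite: Schrijver1986, Cor. 18.7a] -/
theorem isBounded_sectionInstance {rows : List ((Fin (k + 1) → ℤ) × ℤ)}
    {U U' : Matrix (Fin (k + 1)) (Fin (k + 1)) ℤ} (hU : U * U' = 1) (κ : ℤ)
    (hb : IsBounded ⟨k + 1, rows⟩) : (sectionInstance rows U κ).IsBounded := by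
  obtain ⟨R, hR⟩ := (Metric.isBounded_iff_subset_closedBall 0).1 hb
  -- a bound on each coordinate of `z` in terms of `‖x‖ ≤ R`
  let C : ℝ := ∑ j : Fin k, ∑ i : Fin (k + 1), |(U' i (Fin.castSucc j) : ℝ)| * |R|
  refine (Metric.isBounded_closedBall (x := (0 : Fin k → ℝ)) (r := C)).subset fun z hz => ?_
  have hx : paramPointR U κ z ∈ Metric.closedBall (0 : Fin (k + 1) → ℝ) R :=
    hR ((mem_polyhedron_sectionInstance_iff rows U κ z).1 hz)
  rw [Metric.mem_closedBall, dist_zero_right] at hx ⊢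
  have hxi : ∀ i, |paramPointR U κ z i| ≤ |R| := fun i =>
    ((Real.norm_eq_abs _).symm.le.trans (norm_le_pi_norm _ i)).trans (hx.trans (le_abs_self R))
  have hzj : ∀ j : Fin k, |z j| ≤ ∑ i : Fin (k + 1), |(U' i (Fin.castSucc j) : ℝ)| * |R| := by
    intro j
    rw [param_eq_sum_paramPointR hU κ z j]
    refine (Finset.abs_sum_le_sum_abs _ _).trans (Finset.sum_le_sum fun i _ => ?_)
    rw [abs_mul, mul_comm]
    exact mul_le_mul_of_nonneg_left (hxi i) (abs_nonneg _)
  have hC : ∀ j : Fin k, ∑ i : Fin (k + 1), |(U' i (Fin.castSucc j) : ℝ)| * |R| ≤ C := fun j =>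
    Finset.single_le_sum (f := fun j : Fin k => ∑ i : Fin (k + 1), |(U' i (Fin.castSucc j) : ℝ)| * |R|)
      (fun j _ => Finset.sum_nonneg fun i _ => by positivity) (Finset.mem_univ j)
  refine (pi_norm_le_iff_of_nonneg (Finset.sum_nonneg fun j _ => Finset.sum_nonneg fun i _ => by positivity)).2
    fun j => ?_
  rw [Real.norm_eq_abs]
  exact (hzj j).trans (hC j)

end FixedDimILP

end Literature.Computability.Complexity
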